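import Literature.MathematicalPhysics.KineticTheory.DiPernaLionsApproxSupersolution
import HarnessLib

/-!
# Truncation of the Duhamel gain term at a level of the density (subsolution half of CIP L. 5.3.12)

Topic: MathematicalPhysics / KineticTheory. Infrastructure for the named fact (L12)
`diPernaLions_limit_expDuhamel` (Cercignani–Illner–Pulvirenti 1994 §5.3 Lemma 5.3.12). The
subsolution half of Lemma 5.3.12 (pp. 158–159, (3.41)–(3.44)) has to bound the damped Duhamel
gain term `T_{Fₙ}⁻¹ Q̃₊ⁿ(fⁿ,fⁿ)(t)` of the exponential form (3.36) *from above* in the limit,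
although `Q̃₊ⁿ(fⁿ,fⁿ)` is not weakly compact — only `Q̃₊ⁿ(fⁿ,fⁿ)/(1 + fⁿ)` is (Lemma 5.3.7). CIP
renormalise (`hₘⁿ = m ln(1 + fⁿ/m)`, (3.41)); the tree's proof instead truncates the gain term at a
level `M` of the density *along the characteristic*, which the exponential form makes harmless:

* `IsDiPernaLionsApproximateSolution.sharp_le_exp_mul_sharp` (**Gronwall along characteristics**,
  from (3.36) with a nonnegative gain term): `f♯(s) ≤ e^{Λ♯(t) - Λ♯(s)} f♯(t)` for `0 ≤ s ≤ t`;
  hence (`sharp_le_of_level`) `f♯(s) ≤ M` for all `s ∈ [0, t]` as soon as `e^{Λ♯(t)} f♯(t) ≤ M`.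
* `IsDiPernaLionsApproximateSolution.dampedGain_le_levelCut_add` (**the level truncation**): the
  damped gain primitive `∫₀ᵗ a♯ Q₊(f,f)♯ e^{-(Λ♯(t)-Λ♯(s))} ds ∈ [0,∞]` of (3.36) equals the same
  integral with the extra factor `1_{f♯(s) ≤ M}` off the set `{e^{Λ♯(t)} f♯(t) > M}`, and is at
  most `f♯(t)` everywhere (by (3.36)); so it is bounded by the level-truncated primitive plus
  `f♯(t) 1_{e^{Λ♯(t)} f♯(t) > M}`. Integrated over a set of characteristics
  (`lintegral_dampedGain_le_levelCut_add`), with the measure of the exceptional set controlled by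
  Markov's inequality (`measure_level_gt_le`): `|{e^{Λ♯(t)} f♯(t) > M} ∩ C| ≤ L₀⁻¹ ∫_C Λ♯(t) +
  e^{L₀} M⁻¹ ∫ f♯(t)`.

The level-truncated gain `a 1_{f ≤ M} Q₊(f,f) ≤ (1 + M) a Q₊(f,f)/(1+f)` is weakly compact by
Lemma 5.3.7, which is what the passage to the limit downstream uses. Everything here is proved;
no definition and no named fact is introduced.

## References

* C. Cercignani, R. Illner, M. Pulvirenti, *The Mathematical Theory of Dilute Gases*, Springer
  (1994), §5.3 Step 13 (3.36) (p. 157) and proof of Lemma 5.3.12 (pp. 158–159).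
* R. J. DiPerna, P.-L. Lions, *On the Cauchy problem for Boltzmann equations: global existence and
  weak stability*, Ann. of Math. 130 (1989) 321–366.
-/

open MeasureTheory Metric Real Set Filter Topology
open scoped InnerProductSpace ENNReal

noncomputable section

namespace Literature.MathematicalPhysics.KineticTheory

open Literature.Analysis.FluidPDE

variable {E : Type*} [NormedAddCommGroup E] [InnerProductSpace ℝ E] [FiniteDimensional ℝ E]
  [MeasurableSpace E] [BorelSpace E]

section Single

variable {δ : ℝ} {B : E × E → sphere (0 : E) 1 → ℝ} {f : ℝ → E → E → ℝ}

/-- **Gronwall along characteristics** (from the exponential form (3.36) of CIP 1994 §5.3 Step 13,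
p. 157, whose Duhamel integrand is nonnegative): for an approximate solution `f` with a bounded
DiPerna–Lions kernel vanishing for large relative velocities and `δ ≥ 0`,
`f♯(s, x, v) ≤ e^{Λ♯(t,x,v) - Λ♯(s,x,v)} f♯(t, x, v)` for `0 ≤ s ≤ t`. [cite: CIPDiluteGases1994, §5.3 Step 13 (3.36) (p. 157)] -/
theorem IsDiPernaLionsApproximateSolution.sharp_le_exp_mul_sharp
    (hf : IsDiPernaLionsApproximateSolution δ B f) (hBk : IsDiPernaLionsKernel B) {Cb : ℝ}
    (hCb : ∀ p ω, B p ω ≤ Cb) {Rb : ℝ} (hRb : ∀ (z : E) ω, Rb ≤ ‖z‖ → B (z, 0) ω = 0)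
    (hδ : 0 ≤ δ) {s t : ℝ} (hs : 0 ≤ s) (hst : s ≤ t) (x v : E) :
    f s (x + s • v) v ≤ exp (truncatedDampingExponent δ B f t x v -
      truncatedDampingExponent δ B f s x v) * f t (x + t • v) v := by
  have hBm := hBk.measurable
  have hB0 := hBk.nonneg
  have ht : 0 ≤ t := hs.trans hst
  set Λ : ℝ → ℝ := fun σ => truncatedDampingExponent δ B f σ x v with hΛ
  set G : ℝ → ℝ := fun σ => truncatedGain δ B f σ (x + σ • v) v with hG
  have hexp_t := hf.expForm hBk hCb hRb hδ t ht x v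
  have hexp_s := hf.expForm hBk hCb hRb hδ s hs x v
  -- integrability and sign of the Duhamel integrand on `(0, t]`
  have hΛc : ContinuousOn Λ (Icc 0 t) :=
    hf.continuousOn_truncatedDampingExponent_sharp hBm hB0 hCb hδ x v ht
  have hGe_cont : ContinuousOn (fun σ => G σ * exp (-(Λ t - Λ σ))) (Icc 0 t) :=
    (hf.continuousOn_truncatedGain_sharp hBk hCb hRb hδ x v ht).mul
      (continuousOn_const.sub hΛc).neg.rexp
  have hint : IntegrableOn (fun σ => G σ * exp (-(Λ t - Λ σ))) (Ioc 0 t) :=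
    hGe_cont.integrableOn_Icc.mono_set Ioc_subset_Icc_self
  have hnn : 0 ≤ᵐ[volume.restrict (Ioc 0 t)] fun σ => G σ * exp (-(Λ t - Λ σ)) := by
    filter_upwards [ae_restrict_mem measurableSet_Ioc] with σ hσ
    exact mul_nonneg (truncatedGain_nonneg hB0 hδ (fun w => hf.nonneg σ hσ.1.le _ _) _)
      (exp_pos _).le
  -- the key inequality `e^{-(Λ t - Λ s)} f♯(s) ≤ f♯(t)`
  have hkey : exp (-(Λ t - Λ s)) * f s (x + s • v) v ≤ f t (x + t • v) v := by
    have h1 : exp (-(Λ t - Λ s)) * f s (x + s • v) v =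
        f 0 x v * exp (-(Λ t)) + ∫ σ in Ioc 0 s, G σ * exp (-(Λ t - Λ σ)) := by
      rw [hexp_s]
      change exp (-(Λ t - Λ s)) * (f 0 x v * exp (-(Λ s)) +
        ∫ σ in Ioc 0 s, G σ * exp (-(Λ s - Λ σ))) = _
      rw [mul_add, ← integral_const_mul]
      congr 1
      · rw [mul_comm, mul_assoc, ← Real.exp_add]
        congr 2; ring
      · refine integral_congr_ae (ae_of_all _ fun σ => ?_)
        change exp (-(Λ t - Λ s)) * (G σ * exp (-(Λ s - Λ σ))) = G σ * exp (-(Λ t - Λ σ))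
        rw [mul_left_comm, ← Real.exp_add]
        congr 2; ring
    have h2 : ∫ σ in Ioc 0 s, G σ * exp (-(Λ t - Λ σ)) ≤ ∫ σ in Ioc 0 t, G σ * exp (-(Λ t - Λ σ)) :=
      setIntegral_mono_set hint hnn (ae_of_all _ (Ioc_subset_Ioc_right hst))
    rw [h1]
    change _ ≤ f t (x + t • v) v
    rw [hexp_t]
    exact add_le_add le_rfl h2
  -- multiply by `e^{Λ t - Λ s}`
  have hpos : 0 < exp (Λ t - Λ s) := exp_pos _
  calc f s (x + s • v) v = exp (Λ t - Λ s) * (exp (-(Λ t - Λ s)) * f s (x + s • v) v) := by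
        rw [← mul_assoc, ← Real.exp_add, add_neg_cancel, Real.exp_zero, one_mul]
    _ ≤ exp (Λ t - Λ s) * f t (x + t • v) v := mul_le_mul_of_nonneg_left hkey hpos.le

/-- **Below a level along the whole characteristic**: if `e^{Λ♯(t,x,v)} f♯(t,x,v) ≤ M` then
`f♯(s,x,v) ≤ M` for all `s ∈ [0, t]` (`sharp_le_exp_mul_sharp` and `Λ♯ ≥ 0`). [cite: CIPDiluteGases1994, §5.3 Step 13 (3.36) (p. 157)] -/
theorem IsDiPernaLionsApproximateSolution.sharp_le_of_level
    (hf : IsDiPernaLionsApproximateSolution δ B f) (hBk : IsDiPernaLionsKernel B) {Cb : ℝ}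
    (hCb : ∀ p ω, B p ω ≤ Cb) {Rb : ℝ} (hRb : ∀ (z : E) ω, Rb ≤ ‖z‖ → B (z, 0) ω = 0)
    (hδ : 0 ≤ δ) {s t : ℝ} (hs : 0 ≤ s) (hst : s ≤ t) (x v : E) {M : ℝ}
    (hM : exp (truncatedDampingExponent δ B f t x v) * f t (x + t • v) v ≤ M) :
    f s (x + s • v) v ≤ M := by
  have hB0 := hBk.nonneg
  have hΛs : 0 ≤ truncatedDampingExponent δ B f s x v :=
    truncatedDampingExponent_nonneg hB0 hδ hf.nonneg s x v
  have hft : 0 ≤ f t (x + t • v) v := hf.nonneg t (hs.trans hst) _ _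
  calc f s (x + s • v) v ≤ exp (truncatedDampingExponent δ B f t x v -
        truncatedDampingExponent δ B f s x v) * f t (x + t • v) v :=
        hf.sharp_le_exp_mul_sharp hBk hCb hRb hδ hs hst x v
    _ ≤ exp (truncatedDampingExponent δ B f t x v) * f t (x + t • v) v := by
        refine mul_le_mul_of_nonneg_right (exp_le_exp.2 ?_) hft
        linarith
    _ ≤ M := hM

/-- **The level truncation of the damped gain primitive** (the tree's replacement for the
renormalisation (3.41) of CIP 1994 §5.3, proof of Lemma 5.3.12, pp. 158–159): for `t ≥ 0`, every
characteristic `(x, v)` and every level `M`, the damped gain primitive of the exponential form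
(3.36), `∫₀ᵗ a♯(s) Q₊(f,f)♯(s) e^{-(Λ♯(t)-Λ♯(s))} ds ∈ [0, ∞]` (true gain integral `eGain`,
`a = (1 + δ ∫ |f| dw)⁻¹`), is at most the same primitive with the extra factor `1_{f♯(s) ≤ M}`
plus `f♯(t) 1_{e^{Λ♯(t)} f♯(t) > M}`: off the exceptional set the two primitives coincide
(`sharp_le_of_level`), and the primitive never exceeds `f♯(t)` ((3.36),
`ofReal_sharp_eq_lintegral`). [cite: CIPDiluteGases1994, §5.3 Step 13 (3.36) (p. 157) and proof of Lemma 5.3.12 (pp. 158–159)] -/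
theorem IsDiPernaLionsApproximateSolution.dampedGain_le_levelCut_add
    (hf : IsDiPernaLionsApproximateSolution δ B f) (hBk : IsDiPernaLionsKernel B) {Cb : ℝ}
    (hCb : ∀ p ω, B p ω ≤ Cb) {Rb : ℝ} (hRb : ∀ (z : E) ω, Rb ≤ ‖z‖ → B (z, 0) ω = 0)
    (hδ : 0 ≤ δ) (t : ℝ) (ht : 0 ≤ t) (x v : E) (M : ℝ) :
    ∫⁻ s in Ioc 0 t, ENNReal.ofReal ((1 + δ * ∫ w, |f s (x + s • v) w|)⁻¹) *
        eGain B f (s, x + s • v, v) *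
        ENNReal.ofReal (exp (-(truncatedDampingExponent δ B f t x v -
          truncatedDampingExponent δ B f s x v))) ≤
      (∫⁻ s in Ioc 0 t, (Iic M).indicator (fun _ => (1 : ℝ≥0∞)) (f s (x + s • v) v) *
        (ENNReal.ofReal ((1 + δ * ∫ w, |f s (x + s • v) w|)⁻¹) *
          eGain B f (s, x + s • v, v) *
          ENNReal.ofReal (exp (-(truncatedDampingExponent δ B f t x v -
            truncatedDampingExponent δ B f s x v))))) +
      (Ioi M).indicator (fun _ => (1 : ℝ≥0∞))
          (exp (truncatedDampingExponent δ B f t x v) * f t (x + t • v) v) *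
        ENNReal.ofReal (f t (x + t • v) v) := by
  by_cases hM : exp (truncatedDampingExponent δ B f t x v) * f t (x + t • v) v ≤ M
  · -- off the exceptional set the two primitives coincide
    have hind : (Ioi M).indicator (fun _ => (1 : ℝ≥0∞))
        (exp (truncatedDampingExponent δ B f t x v) * f t (x + t • v) v) = 0 := by
      rw [indicator_of_notMem]; simpa using hM
    rw [hind, zero_mul, add_zero]
    refine le_of_eq (setLIntegral_congr_fun measurableSet_Ioc fun s hs => ?_)
    have hle : f s (x + s • v) v ≤ M := hf.sharp_le_of_level hBk hCb hRb hδ hs.1.le hs.2 x v hM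
    rw [indicator_of_mem (show f s (x + s • v) v ∈ Iic M from hle), one_mul]
  · -- on the exceptional set, bound by `f♯(t)`
    have hind : (Ioi M).indicator (fun _ => (1 : ℝ≥0∞))
        (exp (truncatedDampingExponent δ B f t x v) * f t (x + t • v) v) = 1 := by
      rw [indicator_of_mem]; simpa using hM
    rw [hind, one_mul]
    calc _ ≤ ENNReal.ofReal (f t (x + t • v) v) := by
          rw [hf.ofReal_sharp_eq_lintegral hBk hCb hRb hδ t ht x v]
          exact le_add_self
      _ ≤ _ := le_add_self

/-- The level-truncated damped gain primitive is at most the full one, hence at most `f♯(t)`.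
[cite: CIPDiluteGases1994, §5.3 Step 13 (3.36) (p. 157)] -/
theorem IsDiPernaLionsApproximateSolution.levelCut_dampedGain_le_sharp
    (hf : IsDiPernaLionsApproximateSolution δ B f) (hBk : IsDiPernaLionsKernel B) {Cb : ℝ}
    (hCb : ∀ p ω, B p ω ≤ Cb) {Rb : ℝ} (hRb : ∀ (z : E) ω, Rb ≤ ‖z‖ → B (z, 0) ω = 0)
    (hδ : 0 ≤ δ) (t : ℝ) (ht : 0 ≤ t) (x v : E) (M : ℝ) :
    (∫⁻ s in Ioc 0 t, (Iic M).indicator (fun _ => (1 : ℝ≥0∞)) (f s (x + s • v) v) *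
        (ENNReal.ofReal ((1 + δ * ∫ w, |f s (x + s • v) w|)⁻¹) *
          eGain B f (s, x + s • v, v) *
          ENNReal.ofReal (exp (-(truncatedDampingExponent δ B f t x v -
            truncatedDampingExponent δ B f s x v))))) ≤
      ENNReal.ofReal (f t (x + t • v) v) := by
  calc _ ≤ ∫⁻ s in Ioc 0 t, ENNReal.ofReal ((1 + δ * ∫ w, |f s (x + s • v) w|)⁻¹) *
        eGain B f (s, x + s • v, v) *
        ENNReal.ofReal (exp (-(truncatedDampingExponent δ B f t x v -
          truncatedDampingExponent δ B f s x v))) := by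
        refine lintegral_mono fun s => ?_
        have hind : (Iic M).indicator (fun _ => (1 : ℝ≥0∞)) (f s (x + s • v) v) ≤ 1 :=
          indicator_apply_le' (fun _ => le_rfl) (fun _ => zero_le_one)
        calc _ ≤ 1 * (ENNReal.ofReal ((1 + δ * ∫ w, |f s (x + s • v) w|)⁻¹) *
              eGain B f (s, x + s • v, v) *
              ENNReal.ofReal (exp (-(truncatedDampingExponent δ B f t x v -
                truncatedDampingExponent δ B f s x v)))) := by gcongr
          _ = _ := one_mul _
    _ ≤ ENNReal.ofReal (f t (x + t • v) v) := by
        rw [hf.ofReal_sharp_eq_lintegral hBk hCb hRb hδ t ht x v]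
        exact le_add_self

/-- **Markov bound for the exceptional set of the level truncation**: for `L₀ > 0`, `M > 0` and
a measurable set `C` of characteristics,
`|C ∩ {e^{Λ♯(t)} f♯(t) > M}| ≤ (∫_C Λ♯(t)) / L₀ + (∫_C f♯(t)) / (M e^{-L₀})`, since the
exceptional set lies in `{Λ♯(t) ≥ L₀} ∪ {f♯(t) ≥ M e^{-L₀}}`. [folklore] -/
theorem measure_level_gt_le {Λ F : E × E → ℝ} (hΛm : Measurable Λ) (hFm : Measurable F)
    (hF0 : ∀ z, 0 ≤ F z) {C : Set (E × E)} (hC : MeasurableSet C) {L₀ M : ℝ} (hL₀ : 0 < L₀)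
    (hM : 0 < M) :
    ((volume : Measure E).prod volume) (C ∩ {z | M < exp (Λ z) * F z}) ≤
      (∫⁻ z in C, ENNReal.ofReal (Λ z) ∂((volume : Measure E).prod volume)) / ENNReal.ofReal L₀ +
      (∫⁻ z in C, ENNReal.ofReal (F z) ∂((volume : Measure E).prod volume)) /
        ENNReal.ofReal (M * exp (-L₀)) := by
  set μ := ((volume : Measure E).prod volume).restrict C with hμ
  have hsub : C ∩ {z | M < exp (Λ z) * F z} ⊆
      C ∩ ({z | ENNReal.ofReal L₀ ≤ ENNReal.ofReal (Λ z)} ∪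
        {z | ENNReal.ofReal (M * exp (-L₀)) ≤ ENNReal.ofReal (F z)}) := by
    rintro z ⟨hzC, hz⟩
    refine ⟨hzC, ?_⟩
    simp only [mem_setOf_eq, mem_union]
    by_contra h
    push Not at h
    obtain ⟨h1, h2⟩ := h
    have h1' : Λ z < L₀ := (ENNReal.ofReal_lt_ofReal_iff hL₀).1 h1
    have h2' : F z < M * exp (-L₀) := (ENNReal.ofReal_lt_ofReal_iff (mul_pos hM (exp_pos _))).1 h2
    have h3 : exp (Λ z) * F z < exp L₀ * (M * exp (-L₀)) :=
      mul_lt_mul'' (exp_lt_exp.2 h1') h2' (exp_pos _).le (hF0 z)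
    rw [mul_left_comm, ← Real.exp_add, add_neg_cancel, Real.exp_zero, mul_one] at h3
    exact lt_irrefl _ (h3.trans hz)
  calc ((volume : Measure E).prod volume) (C ∩ {z | M < exp (Λ z) * F z})
      ≤ ((volume : Measure E).prod volume) (C ∩ ({z | ENNReal.ofReal L₀ ≤ ENNReal.ofReal (Λ z)} ∪
          {z | ENNReal.ofReal (M * exp (-L₀)) ≤ ENNReal.ofReal (F z)})) := measure_mono hsub
    _ = μ ({z | ENNReal.ofReal L₀ ≤ ENNReal.ofReal (Λ z)} ∪
          {z | ENNReal.ofReal (M * exp (-L₀)) ≤ ENNReal.ofReal (F z)}) := by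
        rw [hμ, Measure.restrict_apply' hC, inter_comm]
    _ ≤ μ {z | ENNReal.ofReal L₀ ≤ ENNReal.ofReal (Λ z)} +
          μ {z | ENNReal.ofReal (M * exp (-L₀)) ≤ ENNReal.ofReal (F z)} := measure_union_le _ _
    _ ≤ (∫⁻ z, ENNReal.ofReal (Λ z) ∂μ) / ENNReal.ofReal L₀ +
          (∫⁻ z, ENNReal.ofReal (F z) ∂μ) / ENNReal.ofReal (M * exp (-L₀)) := by
        gcongr
        · exact meas_ge_le_lintegral_div hΛm.ennreal_ofReal.aemeasurable
            (by simpa using hL₀) ENNReal.ofReal_ne_top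
        · exact meas_ge_le_lintegral_div hFm.ennreal_ofReal.aemeasurable
            (by simpa using mul_pos hM (exp_pos _)) ENNReal.ofReal_ne_top

/-- **The level truncation, integrated over a measurable set of characteristics**: for `t ≥ 0`, a
level `M` and a set `C ⊆ E × E` of characteristics,
`∫_C T_Λ⁻¹(a Q₊(f,f))♯(t) ≤ ∫_C T_Λ⁻¹(a 1_{f ≤ M} Q₊(f,f))♯(t) + ∫_{C ∩ {e^{Λ♯(t)} f♯(t) > M}} f♯(t)`
(`dampedGain_le_levelCut_add` pointwise). [cite: CIPDiluteGases1994, §5.3 Step 13 (3.36) (p. 157) and proof of Lemma 5.3.12 (pp. 158–159)] -/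
theorem IsDiPernaLionsApproximateSolution.lintegral_dampedGain_le_levelCut_add
    (hf : IsDiPernaLionsApproximateSolution δ B f) (hBk : IsDiPernaLionsKernel B) {Cb : ℝ}
    (hCb : ∀ p ω, B p ω ≤ Cb) {Rb : ℝ} (hRb : ∀ (z : E) ω, Rb ≤ ‖z‖ → B (z, 0) ω = 0)
    (hδ : 0 ≤ δ) (t : ℝ) (ht : 0 ≤ t) (M : ℝ) (C : Set (E × E))
    (hΛm : Measurable fun z : E × E => truncatedDampingExponent δ B f t z.1 z.2) :
    ∫⁻ z in C, (∫⁻ s in Ioc 0 t, ENNReal.ofReal ((1 + δ * ∫ w, |f s (z.1 + s • z.2) w|)⁻¹) *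
        eGain B f (s, z.1 + s • z.2, z.2) *
        ENNReal.ofReal (exp (-(truncatedDampingExponent δ B f t z.1 z.2 -
          truncatedDampingExponent δ B f s z.1 z.2)))) ∂((volume : Measure E).prod volume) ≤
      (∫⁻ z in C, (∫⁻ s in Ioc 0 t, (Iic M).indicator (fun _ => (1 : ℝ≥0∞)) (f s (z.1 + s • z.2) z.2) *
        (ENNReal.ofReal ((1 + δ * ∫ w, |f s (z.1 + s • z.2) w|)⁻¹) *
          eGain B f (s, z.1 + s • z.2, z.2) *
          ENNReal.ofReal (exp (-(truncatedDampingExponent δ B f t z.1 z.2 -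
            truncatedDampingExponent δ B f s z.1 z.2))))) ∂((volume : Measure E).prod volume)) +
      ∫⁻ z in C ∩ {z | M < exp (truncatedDampingExponent δ B f t z.1 z.2) * f t (z.1 + t • z.2) z.2},
        ENNReal.ofReal (f t (z.1 + t • z.2) z.2) ∂((volume : Measure E).prod volume) := by
  set S : Set (E × E) := {z | M < exp (truncatedDampingExponent δ B f t z.1 z.2) *
    f t (z.1 + t • z.2) z.2} with hS
  -- measurability of the exceptional set and of `f♯(t)`
  have hcont : Continuous fun z : E × E => f t (z.1 + t • z.2) z.2 := by
    have h1 : Continuous fun z : E × E => ((t, z.1 + t • z.2, z.2) : ℝ × E × E) := by fun_prop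
    have h2 := hf.contDiffOn.continuousOn
    exact h2.comp_continuous h1 fun z => ⟨(mem_Ici.2 ht), mem_univ _⟩
  have hFm : Measurable fun z : E × E => f t (z.1 + t • z.2) z.2 := hcont.measurable
  have hSm : MeasurableSet S := measurableSet_lt measurable_const (hΛm.exp.mul hFm)
  have hgm : Measurable fun z : E × E => (Ioi M).indicator (fun _ => (1 : ℝ≥0∞))
      (exp (truncatedDampingExponent δ B f t z.1 z.2) * f t (z.1 + t • z.2) z.2) *
        ENNReal.ofReal (f t (z.1 + t • z.2) z.2) :=
    ((measurable_const.indicator measurableSet_Ioi).comp (hΛm.exp.mul hFm)).mul hFm.ennreal_ofReal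
  calc _ ≤ ∫⁻ z in C, ((∫⁻ s in Ioc 0 t, (Iic M).indicator (fun _ => (1 : ℝ≥0∞)) (f s (z.1 + s • z.2) z.2) *
          (ENNReal.ofReal ((1 + δ * ∫ w, |f s (z.1 + s • z.2) w|)⁻¹) *
            eGain B f (s, z.1 + s • z.2, z.2) *
            ENNReal.ofReal (exp (-(truncatedDampingExponent δ B f t z.1 z.2 -
              truncatedDampingExponent δ B f s z.1 z.2))))) +
          (Ioi M).indicator (fun _ => (1 : ℝ≥0∞))
            (exp (truncatedDampingExponent δ B f t z.1 z.2) * f t (z.1 + t • z.2) z.2) *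
            ENNReal.ofReal (f t (z.1 + t • z.2) z.2)) ∂((volume : Measure E).prod volume) :=
        lintegral_mono fun z => hf.dampedGain_le_levelCut_add hBk hCb hRb hδ t ht z.1 z.2 M
    _ = _ := by
        rw [lintegral_add_right _ hgm]
        congr 1
        -- the second integral is the integral of `f♯(t)` over `C ∩ S`
        have hind : ∀ z : E × E, (Ioi M).indicator (fun _ => (1 : ℝ≥0∞))
            (exp (truncatedDampingExponent δ B f t z.1 z.2) * f t (z.1 + t • z.2) z.2) *
            ENNReal.ofReal (f t (z.1 + t • z.2) z.2) =
            S.indicator (fun z => ENNReal.ofReal (f t (z.1 + t • z.2) z.2)) z := by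
          intro z
          by_cases hz : z ∈ S
          · rw [indicator_of_mem hz, indicator_of_mem (show _ ∈ Ioi M from hz), one_mul]
          · rw [indicator_of_notMem hz, indicator_of_notMem (show _ ∉ Ioi M from hz), zero_mul]
        simp_rw [hind]
        rw [lintegral_indicator hSm, Measure.restrict_restrict hSm, inter_comm]

end Single

end Literature.MathematicalPhysics.KineticTheory
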